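import Summits.Langlands.Langlands.Theses.DisagreementBeurling
import Summits.Langlands.Langlands.Theorems.DisagreementBeurlingDefectTable36Eigen
import Literature.NumberTheory.Automorphic.LanglandsTunnellBridge
import Literature.NumberTheory.GaloisRepresentations.DecomposedGenericOfQuadratic
import Literature.RepresentationTheory.FiniteGroups.CharacterCentre
import HarnessLib

/-!
# DisagreementBeurling — `DefectTable36` (stmt-Langlands-13936), part 4: the defect table

Proof of the support item `Summit.Langlands.Langlands.Theses.DisagreementBeurling.DefectTable36`
(binder `h₅` of the route's deciding theorem `closes`).

Let `ρ : Γ_F → GL₃(ℂ)` be irreducible with projective image `Q = PGL-image` of order `36`,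
trivial centre and an element of order `4`, and let the local pattern of `CanonicalDescent36`
hold at almost every place `v`: Satake parameters `α_v`, Frobenius roots `β_v` (unit circle),
`α_v = β_v` unless `β_v² ` has exactly two distinct values, in which case `α_v² = β_v²` and
`∏ α_v = ∏ β_v`.  Then, with a finite alphabet `𝒜` and a `δ > 0`, at almost every place either
`α_v = β_v` or `(α_v, β_v) ∈ 𝒜` and `|Σ α_v|² − |Σ β_v|² ≥ δ`.

* §7 multiset combinatorics: if `card β = 3` and `β²` takes exactly two values then
  `β = {b, b', c}` with `b'² = b²`, `c² ≠ b²`; for `β = {b, −b, c}` the conditions `α² = β²`,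
  `∏ α = ∏ β` force `α ∈ {β, {b, b, −c}, {−b, −b, −c}}`, and the two non-trivial candidates
  have `|Σα|² − |Σβ|² = 2|b ∓ c|² > 0` (part 3, §4);
* §8 assembly: the image `G = ρ(Γ_F)` is finite (`finite_range_framedArtinRep`), acts
  irreducibly (`isIrreducible_glRepresentation_of_range_le`) so `Σ_g |tr g|² = |G|`
  (`Representation.sum_normSq_character`), and `G ↠ Q` has kernel the scalars; part 3 §6
  (**no homology class**) excludes `β_v = {b, b, c}`, so `β_v = {b, −b, c}` at every pattern
  place with `α_v ≠ β_v`; the alphabet is `𝒜 = ⋃_{β ∈ roots(G)} {α ≤ 3·(β + (−β))} × {β}`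
  (finite) and `δ` is the least positive gap over `𝒜`.

No named facts are assumed: every ingredient is a proved tree theorem or Mathlib. [folklore]
-/

set_option linter.dupNamespace false

open scoped BigOperators

namespace Summit.Langlands.Langlands.Theorems.DisagreementBeurlingDefectTable36

open Literature.NumberTheory.GaloisRepresentations Literature.NumberTheory.Automorphic

/-! ### §7 Multiset combinatorics of the local pattern -/

section Multisets

/-- If `card β = 3` and `β²` takes exactly two values then `β = {b, b', c}` with `b'² = b²` and
`c² ≠ b²`. [folklore] -/
theorem shape_of_card_toFinset_sq_eq_two {_inst : DecidableEq ℂ} {β : Multiset ℂ}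
    (h3 : β.card = 3) (h2 : (β.map (· ^ 2)).toFinset.card = 2) :
    ∃ b b' c : ℂ, β = {b, b', c} ∧ b' ^ 2 = b ^ 2 ∧ c ^ 2 ≠ b ^ 2 := by
  obtain ⟨x, y, z, rfl⟩ := Multiset.card_eq_three.mp h3
  have hfin : (( ({x, y, z} : Multiset ℂ).map (· ^ 2)).toFinset) = {x ^ 2, y ^ 2, z ^ 2} := by
    ext t
    simp
  rw [hfin] at h2
  by_cases hxy : x ^ 2 = y ^ 2
  · refine ⟨x, y, z, rfl, hxy.symm, fun hzx => ?_⟩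
    have : ({x ^ 2, y ^ 2, z ^ 2} : Finset ℂ) = {x ^ 2} := by
      rw [← hxy, hzx]
      simp
    rw [this, Finset.card_singleton] at h2
    exact absurd h2 (by norm_num)
  · by_cases hxz : x ^ 2 = z ^ 2
    · refine ⟨x, z, y, ?_, hxz.symm, fun h => hxy h.symm⟩
      show x ::ₘ y ::ₘ z ::ₘ 0 = x ::ₘ z ::ₘ y ::ₘ 0
      rw [Multiset.cons_swap y z]
    · have hyz : y ^ 2 = z ^ 2 := by
        by_contra hyz
        have : ({x ^ 2, y ^ 2, z ^ 2} : Finset ℂ).card = 3 :=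
          Finset.card_eq_three.mpr ⟨_, _, _, hxy, hxz, hyz, rfl⟩
        omega
      refine ⟨y, z, x, ?_, hyz.symm, hxy⟩
      show x ::ₘ y ::ₘ z ::ₘ 0 = y ::ₘ z ::ₘ x ::ₘ 0
      rw [Multiset.cons_swap x y, Multiset.cons_swap x z]

/-- Core of the candidate analysis: `p = ±b`, `q = ±b`, `r = ±c` with `p q r = −b² c`.
[folklore] -/
theorem triple_eq_or_gap_pos {p q r b c : ℂ} (hb : ‖b‖ = 1) (hc : ‖c‖ = 1) (hcb : c ^ 2 ≠ b ^ 2)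
    (hp : p ^ 2 = b ^ 2) (hq : q ^ 2 = b ^ 2) (hr : r ^ 2 = c ^ 2)
    (hprod : p * (q * r) = b * (-b * c)) :
    (({p, q, r} : Multiset ℂ) = {b, -b, c}) ∨
      0 < ‖p + (q + r)‖ ^ 2 - ‖b + (-b + c)‖ ^ 2 := by
  have hb0 : b ≠ 0 := fun h => by rw [h, norm_zero] at hb; exact zero_ne_one hb
  have hc0 : c ≠ 0 := fun h => by rw [h, norm_zero] at hc; exact zero_ne_one hc
  have hbc2 : (2 : ℂ) * b ^ 2 * c ≠ 0 := by
    refine mul_ne_zero (mul_ne_zero two_ne_zero (pow_ne_zero 2 hb0)) hc0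
  have hcb' : c ≠ b := fun h => hcb (by rw [h])
  have hcb'' : c ≠ -b := fun h => hcb (by rw [h, neg_sq])
  rcases sq_eq_sq_iff_eq_or_eq_neg.mp hp with hp' | hp' <;>
  rcases sq_eq_sq_iff_eq_or_eq_neg.mp hq with hq' | hq' <;>
  rcases sq_eq_sq_iff_eq_or_eq_neg.mp hr with hr' | hr' <;>
  rw [hp', hq', hr'] at hprod ⊢
  · exact absurd (by linear_combination hprod) hbc2
  · exact Or.inr (gap_pos_of_ne hb hc hcb')
  · exact Or.inl rfl
  · exact absurd (by linear_combination hprod) hbc2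
  · left
    show -b ::ₘ b ::ₘ c ::ₘ 0 = b ::ₘ -b ::ₘ c ::ₘ 0
    rw [Multiset.cons_swap]
  · exact absurd (by linear_combination hprod) hbc2
  · exact absurd (by linear_combination hprod) hbc2
  · exact Or.inr (gap_pos_of_ne_neg hb hc hcb'')

/-- **The candidates.**  For `β = {b, −b, c}` on the unit circle with `c² ≠ b²`, the
conditions `α² = β²` and `∏ α = ∏ β` force `α = β` or a positive gap `|Σα|² − |Σβ|² > 0`
(the candidates are `{b, b, −c}` and `{−b, −b, −c}`). [folklore] -/
theorem eq_or_gap_pos {α : Multiset ℂ} {b c : ℂ} (hb : ‖b‖ = 1) (hc : ‖c‖ = 1)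
    (hcb : c ^ 2 ≠ b ^ 2) (hsq : α.map (· ^ 2) = ({b, -b, c} : Multiset ℂ).map (· ^ 2))
    (hprod : α.prod = ({b, -b, c} : Multiset ℂ).prod) :
    α = {b, -b, c} ∨ 0 < ‖α.sum‖ ^ 2 - ‖({b, -b, c} : Multiset ℂ).sum‖ ^ 2 := by
  have hcard : α.card = 3 := by
    have := congrArg Multiset.card hsq
    simpa using this
  obtain ⟨p, q, r, rfl⟩ := Multiset.card_eq_three.mp hcard
  have hs : p ^ 2 + q ^ 2 + r ^ 2 = b ^ 2 + b ^ 2 + c ^ 2 := by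
    have := congrArg Multiset.sum hsq
    simp only [Multiset.insert_eq_cons, Multiset.map_cons, Multiset.map_singleton,
      Multiset.sum_cons, Multiset.sum_singleton, neg_sq] at this
    linear_combination this
  have hmem : ∀ t ∈ ({p, q, r} : Multiset ℂ), t ^ 2 = b ^ 2 ∨ t ^ 2 = c ^ 2 := by
    intro t ht
    have h := Multiset.mem_map_of_mem (· ^ 2) ht
    rw [hsq] at h
    simp only [Multiset.insert_eq_cons, Multiset.map_cons, Multiset.map_singleton, neg_sq,
      Multiset.mem_cons, Multiset.mem_singleton] at h
    tauto
  have hp := hmem p (by simp)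
  have hq := hmem q (by simp)
  have hr := hmem r (by simp)
  simp only [Multiset.insert_eq_cons, Multiset.prod_cons, Multiset.prod_singleton] at hprod
  have key : ({p, q, r} : Multiset ℂ) = {b, -b, c} ∨
      0 < ‖p + (q + r)‖ ^ 2 - ‖b + (-b + c)‖ ^ 2 := by
    rcases hp with hp | hp <;> rcases hq with hq | hq <;> rcases hr with hr | hr
    · exact absurd (by linear_combination hp + hq + hr - hs) hcb
    · -- `r² = c²`
      exact triple_eq_or_gap_pos hb hc hcb hp hq hr hprod
    · -- `q² = c²`
      refine (triple_eq_or_gap_pos hb hc hcb hp hr hq (by linear_combination hprod)).imp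
        (fun h => ?_) (fun h => ?_)
      · rw [← h]
        show p ::ₘ q ::ₘ r ::ₘ 0 = p ::ₘ r ::ₘ q ::ₘ 0
        rw [Multiset.cons_swap q r]
      · rwa [add_comm r q] at h
    · exact absurd (by linear_combination hs - hp - hq - hr) hcb
    · -- `p² = c²`
      refine (triple_eq_or_gap_pos hb hc hcb hq hr hp (by linear_combination hprod)).imp
        (fun h => ?_) (fun h => ?_)
      · rw [← h]
        show p ::ₘ q ::ₘ r ::ₘ 0 = q ::ₘ r ::ₘ p ::ₘ 0
        rw [Multiset.cons_swap p q, Multiset.cons_swap p r]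
      · rwa [show q + (r + p) = p + (q + r) by ring] at h
    · exact absurd (by linear_combination hs - hp - hq - hr) hcb
    · exact absurd (by linear_combination hs - hp - hq - hr) hcb
    · exact absurd (by linear_combination (1 / 2 : ℂ) * (hs - hp - hq - hr)) hcb
  rcases key with h | h
  · exact Or.inl h
  · right
    simpa using h

/-- The alphabet bound: if `α² = β²` (as multisets) then `α ≤ 3 • (β + (−β))`. [folklore] -/
theorem le_three_nsmul_of_map_sq_eq {α β : Multiset ℂ} (hcard : α.card ≤ 3)
    (hsq : α.map (· ^ 2) = β.map (· ^ 2)) : α ≤ 3 • (β + β.map Neg.neg) := by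
  classical
  rw [Multiset.le_iff_count]
  intro a
  rw [Multiset.count_nsmul, Multiset.count_add]
  by_cases ha : a ∈ α
  · have h1 : a ^ 2 ∈ β.map (· ^ 2) := hsq ▸ Multiset.mem_map_of_mem (· ^ 2) ha
    obtain ⟨x, hx, hxa⟩ := Multiset.mem_map.mp h1
    have hle : α.count a ≤ 3 := (Multiset.count_le_card a α).trans hcard
    have hβ : 1 ≤ β.count a + (β.map Neg.neg).count a := by
      rcases sq_eq_sq_iff_eq_or_eq_neg.mp hxa.symm with h | h
      · have : 1 ≤ β.count a := Multiset.one_le_count_iff_mem.mpr (h ▸ hx)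
        omega
      · have hmem : a ∈ β.map Neg.neg := Multiset.mem_map.mpr ⟨x, hx, by rw [h]⟩
        have : 1 ≤ (β.map Neg.neg).count a := Multiset.one_le_count_iff_mem.mpr hmem
        omega
    omega
  · rw [Multiset.count_eq_zero_of_notMem ha]
    exact Nat.zero_le _

/-- The set of sub-multisets of a fixed multiset is finite. [folklore] -/
theorem finite_setOf_le (M : Multiset ℂ) : {α : Multiset ℂ | α ≤ M}.Finite := by
  classical
  refine (M.powerset.toFinset.finite_toSet).subset fun α hα => ?_
  simpa [Multiset.mem_powerset] using hα

/-- A finite set of positive reals is bounded below by a positive real. [folklore] -/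
theorem exists_pos_le_of_finite {S : Set ℝ} (hS : S.Finite) (hpos : ∀ s ∈ S, 0 < s) :
    ∃ δ : ℝ, 0 < δ ∧ ∀ s ∈ S, δ ≤ s := by
  by_cases hne : S.Nonempty
  · obtain ⟨m, hm, hmin⟩ := Set.exists_min_image S id hS hne
    exact ⟨m, hpos m hm, fun s hs => hmin s hs⟩
  · refine ⟨1, one_pos, fun s hs => ?_⟩
    exact absurd ⟨s, hs⟩ hne

end Multisets

/-! ### §8 Assembly: the defect table for `3²:4`-type representations -/

section Assembly

/-- **`DefectTable36` (stmt-Langlands-13936).**  For an irreducible `ρ : Γ_F → GL₃(ℂ)` whose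
projective image has order `36`, trivial centre and an element of order `4`, the local pattern
of `CanonicalDescent36` implies the finite-alphabet / positive-defect hypothesis of
`ThinPairDichotomy` at `n = 3`. [folklore] -/
theorem defectTable36 : Summit.Langlands.Langlands.Theses.DisagreementBeurling.DefectTable36 := by
  intro F _ _ ρ hirr htype hcpt P hpat
  classical
  obtain ⟨h36, hZ, h4⟩ := htype
  -- the image `G = ρ(Γ_F)` is finite
  set G : Subgroup (GL (Fin 3) ℂ) := ρ.toMonoidHom.range with hG
  have hfin : (Set.range (ρ : Field.absoluteGaloisGroup F → GL (Fin 3) ℂ)).Finite :=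
    finite_range_framedArtinRep ρ
  haveI : Finite G := by
    have e : (Set.range (ρ : Field.absoluteGaloisGroup F → GL (Fin 3) ℂ)) = (G : Set (GL (Fin 3) ℂ)) := by
      rw [hG, MonoidHom.coe_range]
      rfl
    rw [e] at hfin
    exact hfin.to_subtype
  letI : Fintype G := Fintype.ofFinite G
  -- the projection `π : G ↠ Q` onto the projective image
  have hmemQ : ∀ g : G, (Matrix.ProjGenLinGroup.mk.comp G.subtype) g
      ∈ (Matrix.ProjGenLinGroup.mk.comp ρ.toMonoidHom).range := by
    rintro ⟨_, γ, rfl⟩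
    exact ⟨γ, rfl⟩
  set π : G →* (Matrix.ProjGenLinGroup.mk.comp ρ.toMonoidHom).range :=
    (Matrix.ProjGenLinGroup.mk.comp G.subtype).codRestrict _ hmemQ with hπ
  have hπsurj : Function.Surjective π := by
    rintro ⟨_, γ, rfl⟩
    exact ⟨⟨ρ.toMonoidHom γ, γ, rfl⟩, rfl⟩
  have hker : ∀ g : G, π g = 1 ↔ (g : GL (Fin 3) ℂ) ∈ Subgroup.center (GL (Fin 3) ℂ) := by
    intro g
    rw [← OneMemClass.coe_eq_one]
    exact Matrix.ProjGenLinGroup.mk_eq_one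
  -- irreducibility of `G` and the orthogonality relation
  have hirrG : (glRepresentation G.subtype).IsIrreducible :=
    isIrreducible_glRepresentation_of_range_le (τ := ρ.toMonoidHom) (σ := G.subtype) hirr
      (by rw [hG, Subgroup.range_subtype])
  have horth : ∑ g : G, ‖((g : GL (Fin 3) ℂ) : Matrix (Fin 3) (Fin 3) ℂ).trace‖ ^ 2
      = Fintype.card G := by
    haveI := hirrG
    have h := Literature.RepresentationTheory.FiniteGroups.Representation.sum_normSq_character
      (glRepresentation G.subtype)
    have hchar : ∀ g : G, (glRepresentation G.subtype).character g
        = ((g : GL (Fin 3) ℂ) : Matrix (Fin 3) (Fin 3) ℂ).trace := by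
      intro g
      rw [Representation.character]
      have e : (glRepresentation G.subtype g : (Fin 3 → ℂ) →ₗ[ℂ] (Fin 3 → ℂ))
          = Matrix.toLin' ((g : GL (Fin 3) ℂ) : Matrix (Fin 3) (Fin 3) ℂ) :=
        LinearMap.ext fun v => by rw [glRepresentation_apply_apply, Matrix.toLin'_apply]; rfl
      rw [e, Matrix.trace_toLin'_eq]
    simp only [hchar] at h
    exact h
  -- no homology class in `G`
  have hnohom : ∀ (γ : Field.absoluteGaloisGroup F) {b c : ℂ}, ‖b‖ = 1 → ‖c‖ = 1 → c ^ 2 ≠ b ^ 2 →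
      ((ρ γ : GL (Fin 3) ℂ) : Matrix (Fin 3) (Fin 3) ℂ).charpoly.roots ≠ {b, b, c} := by
    intro γ b c hb hc hcb
    haveI : Finite (Matrix.ProjGenLinGroup.mk.comp ρ.toMonoidHom).range :=
      Nat.finite_of_card_ne_zero (by rw [h36]; norm_num)
    exact roots_ne_of_count π hπsurj hker h36 hZ h4 horth ⟨ρ.toMonoidHom γ, γ, rfl⟩ hb hc hcb
  -- the alphabet and the defect
  set B : Set (Multiset ℂ) := Set.range
    (fun γ : Field.absoluteGaloisGroup F => ((ρ γ : GL (Fin 3) ℂ) : Matrix (Fin 3) (Fin 3) ℂ).charpoly.roots)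
    with hB
  have hBfin : B.Finite := by
    have e : B = (fun M : GL (Fin 3) ℂ => (M : Matrix (Fin 3) (Fin 3) ℂ).charpoly.roots) ''
        Set.range (ρ : Field.absoluteGaloisGroup F → GL (Fin 3) ℂ) := by
      rw [hB, ← Set.range_comp]
      rfl
    rw [e]
    exact hfin.image _
  set 𝒜 : Set (Multiset ℂ × Multiset ℂ) :=
    ⋃ β ∈ B, ({α : Multiset ℂ | α ≤ 3 • (β + β.map Neg.neg)} ×ˢ ({β} : Set (Multiset ℂ))) with h𝒜
  have h𝒜fin : 𝒜.Finite :=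
    hBfin.biUnion fun β _ => (finite_setOf_le _).prod (Set.finite_singleton β)
  obtain ⟨δ, hδ, hδle⟩ := exists_pos_le_of_finite
    ((h𝒜fin.image (fun x : Multiset ℂ × Multiset ℂ => ‖x.1.sum‖ ^ 2 - ‖x.2.sum‖ ^ 2)).inter_of_left
      (Set.Ioi 0)) (fun s hs => hs.2)
  refine ⟨δ, 𝒜, hδ, h𝒜fin, hpat.mono ?_⟩
  rintro v ⟨α, β, hSat, hur, hch, hβ1, hα1, hne2, heq2⟩
  refine ⟨α, β, hSat, hur, hch, hα1, hβ1, ?_⟩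
  by_cases hαβ : α = β
  · exact Or.inl hαβ
  right
  have hcard2 : (β.map (· ^ 2)).toFinset.card = 2 := by
    by_contra h
    exact hαβ (hne2 h)
  obtain ⟨hsq, hprod⟩ := heq2 hcard2
  -- a Frobenius at `v` and its characteristic roots `β`
  obtain ⟨𝔓, h𝔓⟩ := IsDedekindDomain.HeightOneSpectrum.primesAbove_nonempty v
  obtain ⟨σ, hσ⟩ :=
    IsDedekindDomain.HeightOneSpectrum.exists_isArithFrobAt_of_mem_primesAbove_holds h𝔓
  have hchσ : ((ρ σ : GL (Fin 3) ℂ) : Matrix (Fin 3) (Fin 3) ℂ).charpoly = satakePolynomial β :=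
    hch 𝔓 h𝔓 σ hσ
  have hroots : ((ρ σ : GL (Fin 3) ℂ) : Matrix (Fin 3) (Fin 3) ℂ).charpoly.roots = β := by
    rw [hchσ, roots_satakePolynomial]
  have hβ3 : β.card = 3 := by
    rw [← hroots]
    exact card_roots_charpoly_eq_three _
  have hβB : β ∈ B := ⟨σ, hroots⟩
  -- the shape of `β`
  obtain ⟨b, b', c, hβ, hb', hcb⟩ := shape_of_card_toFinset_sq_eq_two hβ3 hcard2
  have hb : ‖b‖ = 1 := hβ1 b (by rw [hβ]; simp)
  have hc : ‖c‖ = 1 := hβ1 c (by rw [hβ]; simp)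
  rcases sq_eq_sq_iff_eq_or_eq_neg.mp hb' with hbb | hbb
  · -- `β = {b, b, c}` is a homology class: excluded
    rw [hbb] at hβ
    exact absurd (hroots.trans hβ) (hnohom σ hb hc hcb)
  · rw [hbb] at hβ
    subst hβ
    rcases eq_or_gap_pos hb hc hcb hsq hprod with h | h
    · exact absurd h hαβ
    · have hmem : (α, ({b, -b, c} : Multiset ℂ)) ∈ 𝒜 := by
        rw [h𝒜]
        refine Set.mem_iUnion₂.mpr ⟨_, hβB, Set.mk_mem_prod ?_ (Set.mem_singleton _)⟩
        have hα3 : α.card ≤ 3 := by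
          have := congrArg Multiset.card hsq
          simp only [Multiset.card_map] at this
          rw [this, hβ3]
        exact le_three_nsmul_of_map_sq_eq hα3 hsq
      exact ⟨hmem, hδle _ ⟨⟨(α, _), hmem, rfl⟩, h⟩⟩

end Assembly

end Summit.Langlands.Langlands.Theorems.DisagreementBeurlingDefectTable36
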